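import Literature.NumberTheory.LFunctions.DirichletExplicitRegionLargeHeight
import Literature.NumberTheory.LFunctions.DirichletExplicitRegionHeightLeOne
import Literature.NumberTheory.LFunctions.DeuringHeilbronnFromDensity
import HarnessLib

/-!
# McCurley's Theorem 1 (1984) — `McCurley1984_theorem1_closed` DISCHARGED

Topic `Literature/NumberTheory/LFunctions`. The named fact
`McCurley1984_theorem1_closed = AtMostOneZeroInClosedRegion 9.645908801 10` of `ZeroFreeRegionUpTo.lean`
(K. S. McCurley, *Explicit zero-free regions for Dirichlet L-functions*, J. Number Theory 19 (1984),
Theorem 1, p. 8: "Let `M = max{k, k|t|, 10}` and `R = 9.645908801`. Then `𝓛_k(s) = ∏_χ L(s,χ)` has at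
most a single zero in the region `σ ≥ 1 − 1/(R log M)`. The only possible zero in this region is a
simple real zero arising from an L-function formed with a real non-principal character", simplicity
not rendered) is PROVED here: `McCurley1984_theorem1_closed_holds`, and with the tree's
`McCurley1984_theorem1_of_closed` also the open-region rendering `McCurley1984_theorem1_holds`.
(The discharge lives in this separate file because the proof files import `ZeroFreeRegionUpTo.lean`
transitively; appending to that file would close an import cycle.)

The proof is McCurley's, formalised clause by clause in
`DirichletExplicitRegion{RealZeros, ComplexPoints, ComplexAssembly, ZetaTerm, SmallHeight, MidHeight,
MidHeightPole, HeightLeOne, GammaUniform, LargeHeight}.lean` (de la Vallée-Poussin's method with the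
Rosser–Schoenfeld polynomial (27) and Stechkin's device; Lemmas 1–10; §4 `|γ| ≥ 1`, §5 `|γ| < 1`, §6
small `|γ|`; Theorem 2 / Page for the real zeros of real characters), the principal character through
`ζ` (`zeta_large_height`; and the kernel-certified `N(14) = 0` for `|t| ≤ 14`), and arbitrary
characters through the primitive character inducing them (conductor `≤ q`, tree's
`LFunction_eq_zero_iff_primitiveCharacter`; principal `L`-function vs `ζ`: tree's
`DeuringHeilbronnFromDensity.riemannZeta_eq_zero_of_LFunction_one_eq_zero`).

## Main results

* `McCurleyStechkin.re_lt_of_im_ne_zero`: no `χ` mod `q ≥ 1` has a zero `s` with `Im s ≠ 0`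
  in the closed region `Re s ≥ 1 − 1/(R log max(q, q|Im s|, 10))`.
* `McCurley1984_theorem1_closed_holds : McCurley1984_theorem1_closed` and
  `McCurley1984_theorem1_holds : McCurley1984_theorem1`.

## References

* K. S. McCurley, J. Number Theory 19 (1984) 7–32, doi:10.1016/0022-314x(84)90089-1, Theorem 1 (p. 8). [McCurley1984ZFR]
-/

noncomputable section

open Real Complex

namespace Literature.NumberTheory.LFunctions

namespace McCurleyStechkin

open DirichletCharacter

/-- `1.609437 ≤ log 5`. [folklore] -/
private theorem log_five_ge_f : (1.609437 : ℝ) ≤ Real.log 5 := by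
  rw [Real.le_log_iff_exp_le (by norm_num)]
  have h1 : Real.exp 1.609437 = Real.exp 1 * Real.exp 0.609437 := by rw [← Real.exp_add]; norm_num
  have h2 : Real.exp 0.609437 ≤ 1.839396 := by
    have h := Real.exp_bound' (x := (0.609437 : ℝ)) (by norm_num) (by norm_num) (n := 7) (by norm_num)
    refine h.trans ?_
    simp only [Finset.sum_range_succ, Finset.sum_range_zero, Nat.factorial]
    norm_num
  rw [h1]
  have := Real.exp_one_lt_d9
  nlinarith [Real.exp_pos 0.609437]

/-- `log 10 ≥ 2.30258`. [folklore] -/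
private theorem log_ten_ge_f : (2.30258 : ℝ) ≤ Real.log 10 := by
  have h : Real.log 10 = Real.log 2 + Real.log 5 := by
    rw [show (10 : ℝ) = 2 * 5 by norm_num, Real.log_mul (by norm_num) (by norm_num)]
  rw [h]
  have h2 := Real.log_two_gt_d9
  have h5 := log_five_ge_f
  linarith

/-- **No complex zero in McCurley's closed region.** For any `χ` mod `q ≥ 1` and any zero `s` of
`L(s, χ)` with `Im s ≠ 0`: `Re s < 1 − 1/(R log M)`, `M = max(q, q|Im s|, 10)`, `R = 9.645908801`.
(`|Im s| ≤ 1`: `re_lt_of_height_le_one`; `|Im s| > 1`: `height_ge_one` for the primitive character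
inducing `χ`, `zeta_large_height` and `N(14) = 0` for the principal character.)
[cite: McCurley1984ZFR, Theorem 1 (p. 8)] -/
theorem re_lt_of_im_ne_zero {q : ℕ} [NeZero q] (χ : DirichletCharacter ℂ q) {s : ℂ}
    (hz : χ.LFunction s = 0) (him0 : s.im ≠ 0) :
    s.re < 1 - 1 / (9.645908801 * Real.log (max (max (q : ℝ) ((q : ℝ) * |s.im|)) 10)) := by
  have hq1 : (1 : ℝ) ≤ q := by exact_mod_cast Nat.one_le_iff_ne_zero.2 (NeZero.ne q)
  by_cases h1t : |s.im| ≤ 1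
  · have hm : max (q : ℝ) ((q : ℝ) * |s.im|) = q := max_eq_left (by nlinarith [abs_nonneg s.im])
    rw [hm]
    exact re_lt_of_height_le_one χ hz him0 h1t
  push Not at h1t
  set M : ℝ := max (max (q : ℝ) ((q : ℝ) * |s.im|)) 10 with hMdef
  set L : ℝ := Real.log M with hLdef
  have hM10 : (10 : ℝ) ≤ M := le_max_right _ _
  have hMpos : 0 < M := by linarith
  have hMqt : (q : ℝ) * |s.im| ≤ M := (le_max_right _ _).trans (le_max_left _ _)
  have hL10 : Real.log 10 ≤ L := Real.log_le_log (by norm_num) hM10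
  have hqt : Real.log q + Real.log |s.im| ≤ L := by
    rw [← Real.log_mul (by linarith) (by linarith)]
    exact Real.log_le_log (by nlinarith) hMqt
  have hlogq : 0 ≤ Real.log q := Real.log_nonneg hq1
  have hL : 2.30258 ≤ L := log_ten_ge_f.trans hL10
  have hLpos : 0 < L := by linarith
  by_contra hcon
  have hw := not_lt.1 hcon
  have hwin : 1 / (9.645908801 * L) ≤ 0.0451 := by
    rw [div_le_iff₀ (by positivity)]; nlinarith
  have hre : 0 < s.re := by linarith
  have hs1 : s ≠ 1 := fun h ↦ him0 (by rw [h]; simp)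
  by_cases h1 : χ = 1
  · subst h1
    have hζ := DeuringHeilbronnFromDensity.riemannZeta_eq_zero_of_LFunction_one_eq_zero hre hs1 hz
    by_cases h14 : |s.im| ≤ 14
    · -- no zeros of ζ with `0 < |Im s| ≤ 14`
      rcases lt_or_gt_of_ne him0 with h | h
      · have h' : 0 < (starRingEnd ℂ s).im := by simp [h]
        have h14' : (starRingEnd ℂ s).im ≤ 14 := by
          simp only [Complex.conj_im]; linarith [(abs_le.1 h14).1]
        have hne := riemannZeta_ne_zero_of_im_pos_of_im_le_fourteen h' h14'
        rw [riemannZeta_conj, hζ, map_zero] at hne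
        exact hne rfl
      · exact riemannZeta_ne_zero_of_im_pos_of_im_le_fourteen h (abs_le.1 h14).2 hζ
    · push Not at h14
      have h := zeta_large_height (L := L) (by linarith) hL10 hζ (by linarith)
      exact hcon h
  -- non-principal: reduce to the primitive character inducing `χ`
  haveI : NeZero χ.conductor := ⟨χ.conductor_ne_zero⟩
  have hzψ : χ.primitiveCharacter.LFunction s = 0 :=
    (DirichletCharacter.LFunction_eq_zero_iff_primitiveCharacter χ hre hs1).1 hz
  have hψ : χ.primitiveCharacter.IsPrimitive := DirichletCharacter.primitiveCharacter_isPrimitive χ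
  have hψ1 : χ.primitiveCharacter ≠ 1 := by
    intro h
    apply h1
    rw [← DirichletCharacter.changeLevel_primitiveCharacter χ, h, DirichletCharacter.changeLevel_one]
  have hcond : (χ.conductor : ℝ) ≤ q := by
    exact_mod_cast Nat.le_of_dvd (Nat.pos_of_ne_zero (NeZero.ne q)) χ.conductor_dvd_level
  have hcond1 : (1 : ℝ) ≤ χ.conductor := by
    exact_mod_cast Nat.one_le_iff_ne_zero.2 χ.conductor_ne_zero
  have hLk : Real.log (χ.conductor : ℝ) + Real.log |s.im| ≤ L :=
    le_trans (by linarith [Real.log_le_log (by linarith : (0:ℝ) < χ.conductor) hcond]) hqt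
  have h := height_ge_one hψ hψ1 hLk hL10 hzψ h1t.le
  exact hcon h

end McCurleyStechkin

/-- **McCurley 1984, Theorem 1 (closed region) — DISCHARGED.** `∏_{χ mod q} L(s, χ)` (`q ≥ 3`) has at
most one zero in `σ ≥ 1 − 1/(R log M)`, `M = max(q, q|t|, 10)`, `R = 9.645908801`; it is real and comes
from a real non-principal character: the named fact `McCurley1984_theorem1_closed` holds.
[cite: McCurley1984ZFR, Theorem 1 (p. 8)] -/
theorem McCurley1984_theorem1_closed_holds : McCurley1984_theorem1_closed := by
  intro q _ hq χ₁ χ₂ s₁ s₂ hs₁ hs₂ hr₁ hr₂ hz₁ hz₂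
  have him₁ : s₁.im = 0 := by
    by_contra h
    have := McCurleyStechkin.re_lt_of_im_ne_zero χ₁ hz₁ h
    linarith
  have him₂ : s₂.im = 0 := by
    by_contra h
    have := McCurleyStechkin.re_lt_of_im_ne_zero χ₂ hz₂ h
    linarith
  exact mccurley1984_theorem1_closed_of_im_eq_zero q hq χ₁ χ₂ s₁ s₂ him₁ him₂ hs₁ hs₂ hr₁ hr₂ hz₁ hz₂

/-- **McCurley 1984, Theorem 1 (open-region rendering) — DISCHARGED** (`McCurley1984_theorem1 =
AtMostOneZeroInRegion 9.645908801 10`, via the tree's `McCurley1984_theorem1_of_closed`).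
[cite: McCurley1984ZFR, Theorem 1 (p. 8)] -/
theorem McCurley1984_theorem1_holds : McCurley1984_theorem1 :=
  McCurley1984_theorem1_of_closed McCurley1984_theorem1_closed_holds

end Literature.NumberTheory.LFunctions
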